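import Literature.AlgebraicGeometry.Frobenioids.CoAngular
import Literature.AlgebraicGeometry.Frobenioids.PerfectionOps
import Literature.AlgebraicGeometry.Frobenioids.PreFrobenioidDataToFunctor
import Literature.AlgebraicGeometry.Frobenioids.UnitTrivializationIsFrobenioid
import Literature.AlgebraicGeometry.Frobenioids.BirationalizationBiratData
import Literature.AlgebraicGeometry.Frobenioids.ModelFrobenioidRationallyStandardProofs
import Literature.AlgebraicGeometry.Frobenioids.FrobenioidRealificationCanonical
import HarnessLib

/-!
# Frobenioids I, §5: Proposition 5.5 (Perfection, Unit-trivialization and Realification of Types) —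
# the sub-DAG statements over THE constructions `C^pf`, `C^un-tr`, `C^birat`, `C^rlf`

Mochizuki, *The geometry of Frobenioids I: the general theory*, Kyushu J. Math. **62** (2008)
293–400, §5, Proposition 5.5 (i)–(iv), kurims text p. 104 ll. 27–44 (proof p. 104 l. 45 – p. 105 l. 29)
[cite: MochizukiFrdI2008, Prop. 5.5 p.104].

**Text (p. 104 ll. 27–44).** "Suppose that `C` is of Frobenius-isotropic and Frobenius-normalized type.
Then: (i) If `A ∈ Ob(C^istr)` maps to an object `A^pf ∈ Ob(C^pf)`, then the natural functor `C → C^pf`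
determines a natural isomorphism `O^▷(A)^pf ⥲ O^▷(A^pf)`. (ii) There is a natural equivalence of
categories [compatible with the functors to the respective elementary Frobenioids] between
`(C^pf)^un-tr` and `(C^un-tr)^pf` and between `(C^pf)^birat` and `(C^birat)^pf`. (iii) If `C` is of
standard (respectively, rationally standard; model) type, then so is `C^pf`. Moreover, `C^un-tr`,
`C^rlf` are always of model type. Finally, suppose further that `C` is not of group-like type. Then if
`C` is of standard (respectively, rationally standard) type, then so are `C^un-tr`, `C^rlf`. (iv) If `C`
is the model Frobenioid associated to data `Φ, B, Div_B : B → Φ^gp` [cf. Theorem 5.2, (ii)], then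
there is a natural equivalence of categories [compatible with the functors to the respective elementary
Frobenioids] between `C^pf` (respectively, `C^un-tr`; `C^rlf`) and the model Frobenioid associated to
the data `Φ^pf, B^pf, B^pf → (Φ^gp)^pf` (respectively, `Φ, Φ^birat, Φ^birat ↪ Φ^gp`;
`Φ^rlf, ℝ · Φ^birat, ℝ · Φ^birat ↪ (Φ^rlf)^gp`)."

**Rendering (cell abc-iut, L1 sub-DAG S7b, L1-lead R70 (3) M10).** This is the PORT of the staged
typing `TypesUnderOperations.lean` (seat abc-iut-L1-t5, sha12 `0aa983624563`) — which stated (i)–(iv)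
over FREE interface data (`PerfectionData`, operations/structure functor of `C^un-tr`,
`RealificationData`; the schema objection of abc-iut-L1-d4) — onto THE constructions now in the tree:
* `C^pf` = `PreFrobenioid.Perfection hF` with `C → C^pf = Perfection.toPf hF`, operations
  `Perfection.ops hF` and structure functor `(Perfection.ops hF).toFunctor : C^pf → F_{Φ^pf}`
  (seats abc-iut-L1-d9 / L1-d1: `PerfectionCategory`, `PerfectionOps`, `PreFrobenioidDataToFunctor`);
* `C^un-tr` = `(PreFrobenioidData.ofFunctor Φ F).Untr` with ITS structure functor
  `untrFunctor hF : C^un-tr → F_Φ` (seat abc-iut-L1-d5; a Frobenioid: `isFrobenioid_untr`);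
* `C^birat` = THE birationalization datum `biratData hF (hasBiratSquares_of_isFrobenioid hF)`
  (seats abc-iut-L6-t8 / L6-t6; `(C^un-tr)^birat = biratData (isFrobenioid_untr hF) (hasBiratSquares_untr hF)`);
* `C^rlf` = `PreFrobenioid.rlf F hΦ` = `realification F (RealificationData.canonical Φ _)` with its
  structure functor `rlfToElem F hΦ : C^rlf → F_{Φ^rlf}`, for `Φ` perf-factorial (seats abc-iut-L1-t5 /
  L1-d2: `FrobenioidRealification`, `RealificationDataCanonical`, `FrobenioidRealificationCanonical`).
Type predicates are bound BY NAME (L1-lead W2-8 (3)): standard = `PreFrobenioidData.IsOfStandardType`,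
rationally standard = `PreFrobenioidData.IsOfRationallyStandardType _ R` (Def. 4.5 (iii)), model =
pre-model (`PreFrobenioid.IsOfPreModelType`, Def. 2.7 (iii)) AND birationally Frobenius-normalized
(`PreFrobenioidData.IsOfBiratFrobenioidNormalizedType` of THE birationalization, Def. 4.5 (i)).

**What remains a parameter / a named hypothesis (disclosed per declaration).**
(a) "`C^pf` is a Frobenioid" ([FrdI] Prop. 3.2 (iii), cone node `FrdI:Prop3.2(iii)`, deferred BY NAME
by L1-lead R52 (3)(ii)) and "`C^birat` is a Frobenioid" (Prop. 4.4 (ii)) and "`C^rlf` is a Frobenioid"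
(Thm. 5.2 (ii) at the realified data) enter — only where `(C^pf)^birat`, `(C^birat)^pf`, `(C^pf)^un-tr → F`,
`(C^rlf)^birat` must be FORMED — as hypotheses `IsFrobenioid (Perfection.ops hF).toFunctor`,
`IsFrobenioid (biratData hF _).ops.toFunctor`, `IsFrobenioid (rlfToElem F hΦ)`: the tree's predicate
`IsFrobenioid` applied to THE objects (no new `Prop` fact). (b) The support predicate `Supp` of
Def. 2.4 (i)(d) (a §2 datum) stays the one free field of the Def. 4.5 (iii) parameters; the other three
fields (`C^birat`, the operations of `C^un-tr`, `(C^un-tr)^birat`) are THE constructions (`rsParams`).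
(c) "compatible with the functors to the respective elementary Frobenioids" is rendered as lying over `D`
(an isomorphism of the composites with the base functors) in (ii) and in the `C^pf` clause of (iv), and
on the nose against the structure functors in the `C^un-tr`/`C^rlf` clauses of (iv) — as in the staged
typing; the divisor-monoid functors of the two sides of (ii) agree only up to the canonical
identification `(Φ^pf of ops) = Φ^pf`, which is not spelled out here (FLAG (ii), weaker than print, said so).
Every `def … : Prop` below is a named statement, NOT asserted; slots `…_holds` are for the provers.
DISCLOSURE: as in the `C^pf` chain, the standing hypothesis "Frobenius-isotropic and Frobenius-normalized
type" is kept as the printed antecedent of each statement although THE constructions are defined for a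
bare Frobenioid. No statement of the paper is strengthened; nothing here bears on [IUTchIII] Cor. 3.12.
-/

noncomputable section

namespace Literature.AlgebraicGeometry.Frobenioids

open CategoryTheory Opposite

universe w v v' u u'

/-! ### The rational-function subfunctor of model data; the perfected model data (Prop. 5.5 (iv)) -/

section ModelData

variable {D : Type u} [Category.{v} D] (Φ B : Dᵒᵖ ⥤ CommMonCat.{w}) (DivB : B ⟶ monoidGp Φ)

/-- For model data `(Φ, B, Div_B)` with `B` group-like, "the group-like monoid determined by the image
of `Div_B`", `Φ^birat ⊆ Φ^gp` (Thm. 5.2 preamble p. 100; `biratSubmonoid`), as a subfunctor of groups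
(staged by abc-iut-L1-t5). [cite: MochizukiFrdI2008, Thm. 5.2 p.100] -/
def GpSubfunctor.ofModelData (hB : ∀ (A : Dᵒᵖ) (b : B.obj A), IsUnit b) :
    GpSubfunctor Φ where
  carrier X :=
    { toSubmonoid := biratSubmonoid Φ B DivB (op X)
      inv_mem' := fun hx => inv_mem_biratSubmonoid (op X) (hB (op X)) hx }
  pull_mem := by
    rintro X Y f c ⟨b, rfl⟩
    exact ⟨(B.map f.op).hom b, (pullGp_divB f b).symm⟩

/-- Perfected model data: a homomorphism `Div_B^pf : B^pf → (Φ^pf)^gp` "`= (Φ^gp)^pf`" compatible with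
`Div_B` along `B → B^pf` and `Φ^gp → (Φ^pf)^gp` — the data "`Φ^pf, B^pf, B^pf → (Φ^gp)^pf`" of Prop. 5.5
(iv) (p. 104 l. 43; the identification `(Φ^gp)^pf = (Φ^pf)^gp` is carried by this compatibility; staged by
abc-iut-L1-t5). [cite: MochizukiFrdI2008, Prop. 5.5 (iv) p.104] -/
def IsPerfectedDiv (DivBpf : perfectionFunctor B ⟶ monoidGp (perfectionFunctor Φ)) : Prop :=
  toPerfectionFunctor B ≫ DivBpf = DivB ≫ Functor.whiskerRight (toPerfectionFunctor Φ) MonGp.functor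

end ModelData

namespace PreFrobenioid

variable {D : Type u} [Category.{v} D] {Φ : Dᵒᵖ ⥤ CommMonCat.{w}}
  {C : Type u'} [Category.{v'} C] (F : C ⥤ ElemFrobenioid Φ)

/-- `O^▷(A)` as a commutative monoid (Remark 1.3.1: `O^▷(A)` is commutative in a Frobenioid,
`endSubmonoid_comm`), the structure needed to form its perfection `O^▷(A)^pf` (staged by abc-iut-L1-t5).
[cite: MochizukiFrdI2008, Rem. 1.3.1 p.25] -/
@[reducible] def endCommMonoid (hF : IsFrobenioid F) (A : C) : CommMonoid (endSubmonoid F A) :=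
  { (inferInstance : Monoid (endSubmonoid F A)) with mul_comm := endSubmonoid_comm F hF }

variable {F}

/-- The Def. 4.5 (iii) parameters of the Frobenioid `F : C → F_Φ` AT THE CONSTRUCTIONS: `C^birat` = THE
birationalization (Prop. 4.4, `biratData`), the operations of `C^un-tr` = those of ITS structure functor
`untrFunctor hF` (Prop. 3.3 (iv)), `(C^un-tr)^birat` = THE birationalization of the Frobenioid `C^un-tr`;
only the support predicate `Supp` of Def. 2.4 (i)(d) (a §2 datum on the divisor monoids) is a parameter.
[cite: MochizukiFrdI2008, Def. 4.5 (iii) p.86] -/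
def rsParams (hF : IsFrobenioid F)
    (Supp : ∀ {X : D}, (PreFrobenioidData.ofFunctor Φ F).Mon X →
      Primes ((PreFrobenioidData.ofFunctor Φ F).Mon X) → Prop) :
    (PreFrobenioidData.ofFunctor Φ F).RSParams where
  B := biratData hF (hasBiratSquares_of_isFrobenioid hF)
  Supp := Supp
  SU := PreFrobenioidData.ofFunctor Φ (untrFunctor hF)
  BU := biratData (isFrobenioid_untr hF) (hasBiratSquares_untr hF)

end PreFrobenioid

/-! ### Proposition 5.5 (i)–(iii) -/

namespace FrdI.Prop55Sub

open PreFrobenioid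

variable {D : Type u} [Category.{v} D] {Φ : Dᵒᵖ ⥤ CommMonCat.{w}}
  {C : Type u'} [Category.{v'} C] (F : C ⥤ ElemFrobenioid Φ)

/-- **Proposition 5.5 (i)** (p. 104 ll. 30–32; named statement over THE perfection): for `C` of
Frobenius-isotropic and Frobenius-normalized type and `A ∈ Ob(C^istr)` with image `A^pf = (A, 1)` in
`C^pf = Perfection hF`, "the natural functor `C → C^pf` determines a natural isomorphism
`O^▷(A)^pf ⥲ O^▷(A^pf)`": a multiplicative bijection from the perfection of the commutative monoid
`O^▷(A)` (Rem. 1.3.1) onto `O^▷((A,1))` (computed in the operations `Perfection.ops hF`) sending the class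
of `α ∈ O^▷(A)` to `(Perfection.toPf hF)(α)`. [cite: MochizukiFrdI2008, Prop. 5.5 (i) p.104] -/
def Prop55i (hF : IsFrobenioid F) (A : C) : Prop :=
  IsOfType (IsFrobeniusIsotropic F) → IsOfType (IsFrobeniusNormalized F) → IsIsotropic F A →
    ∃ e : @Frobenioids.Perfection (endSubmonoid F A) (endCommMonoid F hF A) ≃*
        (Perfection.ops hF).endSubmonoid ((Perfection.toPf hF).obj A),
      ∀ α : endSubmonoid F A,
        (e (@Frobenioids.Perfection.of (endSubmonoid F A) (endCommMonoid F hF A) α)).1 =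
          (Perfection.toPf hF).map (show A ⟶ A from α.1)

/-- **Proposition 5.5 (ii)**, first equivalence (p. 104 ll. 33–34; named statement over THE
constructions): for `C` of Frobenius-isotropic and Frobenius-normalized type, "a natural equivalence of
categories [compatible with the functors to the respective elementary Frobenioids] between
`(C^pf)^un-tr` and `(C^un-tr)^pf`" — `(C^pf)^un-tr` = the unit-trivialisation (Def. 3.1 (iv), quotient by
unit-equivalence) of the operations `Perfection.ops hF`; `(C^un-tr)^pf` = THE perfection of the Frobenioid
`untrFunctor hF`. Compatibility is rendered over `D`: GIVEN that `C^pf` is a Frobenioid (Prop. 3.2 (iii),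
hypothesis `hPf`, which supplies the structure functor `untrFunctor hPf` of `(C^pf)^un-tr`), the
equivalence intertwines the two base functors. FLAG: weaker than print's compatibility with the functors
to `F_{Φ^pf}` (docstring (c) of the file). [cite: MochizukiFrdI2008, Prop. 5.5 (ii) p.104] -/
def Prop55ii_untr (hF : IsFrobenioid F) : Prop :=
  IsOfType (IsFrobeniusIsotropic F) → IsOfType (IsFrobeniusNormalized F) →
    ∃ e : (Perfection.ops hF).Untr ≌ PreFrobenioid.Perfection (isFrobenioid_untr hF),
      ∀ hPf : IsFrobenioid (Perfection.ops hF).toFunctor,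
        Nonempty (e.functor ⋙ (Perfection.ops (isFrobenioid_untr hF)).base ≅
          (PreFrobenioidData.ofFunctor _ (untrFunctor hPf)).base)

/-- **Proposition 5.5 (ii)**, second equivalence (p. 104 ll. 34–35; named statement over THE
constructions): "… and between `(C^pf)^birat` and `(C^birat)^pf`" — GIVEN that `C^pf` and `C^birat` are
Frobenioids (Prop. 3.2 (iii) / Prop. 4.4 (ii): hypotheses `hPf`, `hBi`, needed to FORM THE
birationalization of `C^pf` and THE perfection of `C^birat`), an equivalence
`(C^pf)^birat ≌ (C^birat)^pf` lying over `D`. FLAG as in `Prop55ii_untr`.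
[cite: MochizukiFrdI2008, Prop. 5.5 (ii) p.104] -/
def Prop55ii_birat (hF : IsFrobenioid F) : Prop :=
  IsOfType (IsFrobeniusIsotropic F) → IsOfType (IsFrobeniusNormalized F) →
    ∀ (hPf : IsFrobenioid (Perfection.ops hF).toFunctor)
      (hBi : IsFrobenioid (biratData hF (hasBiratSquares_of_isFrobenioid hF)).ops.toFunctor),
      ∃ e : (biratData hPf (hasBiratSquares_of_isFrobenioid hPf)).Birat ≌ PreFrobenioid.Perfection hBi,
        Nonempty (e.functor ⋙ (Perfection.ops hBi).base ≅
          (biratData hPf (hasBiratSquares_of_isFrobenioid hPf)).ops.base)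

/-- **Proposition 5.5 (iii)**, first sentence, "standard" (p. 104 ll. 36–37; named statement over THE
perfection): if `C` is of standard type then so is `C^pf` (operations `Perfection.ops hF`).
[cite: MochizukiFrdI2008, Prop. 5.5 (iii) p.104] -/
def Prop55iii_pf_standard (hF : IsFrobenioid F) : Prop :=
  IsOfType (IsFrobeniusIsotropic F) → IsOfType (IsFrobeniusNormalized F) →
    (PreFrobenioidData.ofFunctor Φ F).IsOfStandardType → (Perfection.ops hF).IsOfStandardType

/-- **Proposition 5.5 (iii)**, first sentence, "rationally standard" (p. 104 ll. 36–37; named statement):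
if `C` is of rationally standard type (Def. 4.5 (iii), over THE parameters `rsParams hF Supp`) then so is
`C^pf` (over THE parameters of the Frobenioid `C^pf → F_{Φ^pf}`, GIVEN that it is one — hypothesis `hPf`,
Prop. 3.2 (iii) — and a support predicate `SuppPf` on the perfected divisor monoids, Def. 2.4 (i)(d)).
[cite: MochizukiFrdI2008, Prop. 5.5 (iii) p.104] -/
def Prop55iii_pf_ratStd (hF : IsFrobenioid F)
    (Supp : ∀ {X : D}, (PreFrobenioidData.ofFunctor Φ F).Mon X →
      Primes ((PreFrobenioidData.ofFunctor Φ F).Mon X) → Prop)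
    (SuppPf : ∀ {X : D}, (Perfection.ops hF).Mon X → Primes ((Perfection.ops hF).Mon X) → Prop) : Prop :=
  IsOfType (IsFrobeniusIsotropic F) → IsOfType (IsFrobeniusNormalized F) →
    ∀ hPf : IsFrobenioid (Perfection.ops hF).toFunctor,
      (PreFrobenioidData.ofFunctor Φ F).IsOfRationallyStandardType (rsParams hF Supp) →
        (PreFrobenioidData.ofFunctor _ (Perfection.ops hF).toFunctor).IsOfRationallyStandardType
          (rsParams hPf SuppPf)

/-- **Proposition 5.5 (iii)**, first sentence, "model" (p. 104 ll. 36–37; named statement): if `C` is of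
model type — pre-model (Def. 2.7 (iii)) and birationally Frobenius-normalized (Def. 4.5 (i), at THE
birationalization) — then so is `C^pf` (structure functor `(Perfection.ops hF).toFunctor`; THE
birationalization of `C^pf` GIVEN that it is a Frobenioid, hypothesis `hPf`, Prop. 3.2 (iii)).
[cite: MochizukiFrdI2008, Prop. 5.5 (iii) p.104] -/
def Prop55iii_pf_model (hF : IsFrobenioid F) : Prop :=
  IsOfType (IsFrobeniusIsotropic F) → IsOfType (IsFrobeniusNormalized F) →
    ∀ hPf : IsFrobenioid (Perfection.ops hF).toFunctor,
      IsOfPreModelType F ∧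
          PreFrobenioidData.IsOfBiratFrobeniusNormalizedType
            (biratData hF (hasBiratSquares_of_isFrobenioid hF)) →
        IsOfPreModelType (Perfection.ops hF).toFunctor ∧
          PreFrobenioidData.IsOfBiratFrobeniusNormalizedType
            (biratData hPf (hasBiratSquares_of_isFrobenioid hPf))

/-- **Proposition 5.5 (iii)**, "Moreover, `C^un-tr` … [is] always of model type" (p. 104 l. 37; named
statement over THE constructions, CLOSED — no interface parameter): for `C` of Frobenius-isotropic and
Frobenius-normalized type, `C^un-tr → F_Φ` (structure functor `untrFunctor hF`) is of pre-model type
(Def. 2.7 (iii)) and of birationally Frobenius-normalized type at THE birationalization of the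
Frobenioid `C^un-tr` (Def. 4.5 (i)). [cite: MochizukiFrdI2008, Prop. 5.5 (iii) p.104] -/
def Prop55iii_untr_model (hF : IsFrobenioid F) : Prop :=
  IsOfType (IsFrobeniusIsotropic F) → IsOfType (IsFrobeniusNormalized F) →
    IsOfPreModelType (untrFunctor hF) ∧
      PreFrobenioidData.IsOfBiratFrobeniusNormalizedType
        (biratData (isFrobenioid_untr hF) (hasBiratSquares_untr hF))

/-- **Proposition 5.5 (iii)**, "Moreover, … `C^rlf` [is] always of model type" (p. 104 l. 37; named
statement over THE realification): for `Φ` perf-factorial and `C` a Frobenioid of Frobenius-isotropic and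
Frobenius-normalized type, `C^rlf = rlf F hΦ` with structure functor `rlfToElem F hΦ` is of pre-model
type, and — GIVEN that `C^rlf → F_{Φ^rlf}` is a Frobenioid (Thm. 5.2 (ii) at the data
`(Φ^rlf, ℝ · Φ^birat)`, hypothesis `hR`, needed to FORM THE birationalization of `C^rlf`) — of
birationally Frobenius-normalized type. [cite: MochizukiFrdI2008, Prop. 5.5 (iii) p.104] -/
def Prop55iii_rlf_model (hΦ : IsPerfFactorialOn Φ) : Prop :=
  IsFrobenioid F → IsOfType (IsFrobeniusIsotropic F) → IsOfType (IsFrobeniusNormalized F) →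
    IsOfPreModelType (rlfToElem F hΦ) ∧
      ∀ hR : IsFrobenioid (rlfToElem F hΦ),
        PreFrobenioidData.IsOfBiratFrobeniusNormalizedType
          (biratData hR (hasBiratSquares_of_isFrobenioid hR))

/-- **Proposition 5.5 (iii)**, "Finally", standard type (p. 104 ll. 37–39; named statement over THE
constructions): for `C` moreover NOT of group-like type, if `C` is of standard type then so are `C^un-tr`
(operations of `untrFunctor hF`) and, for `Φ` perf-factorial, `C^rlf` (operations of `rlfToElem F hΦ`).
[cite: MochizukiFrdI2008, Prop. 5.5 (iii) p.104] -/
def Prop55iii_untr_rlf_standard (hF : IsFrobenioid F) (hΦ : IsPerfFactorialOn Φ) : Prop :=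
  IsOfType (IsFrobeniusIsotropic F) → IsOfType (IsFrobeniusNormalized F) →
    ¬ IsOfType (IsGroupLikeObj F) → (PreFrobenioidData.ofFunctor Φ F).IsOfStandardType →
      (PreFrobenioidData.ofFunctor Φ (untrFunctor hF)).IsOfStandardType ∧
        (PreFrobenioidData.ofFunctor _ (rlfToElem F hΦ)).IsOfStandardType

/-- **Proposition 5.5 (iii)**, "Finally", rationally standard type (p. 104 ll. 37–39; named statement):
for `C` moreover NOT of group-like type, if `C` is of rationally standard type (over THE parameters
`rsParams hF Supp`) then so are `C^un-tr` (over THE parameters of the Frobenioid `untrFunctor hF`, support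
predicate `Supp` again — same divisor monoid `Φ`) and `C^rlf` (over THE parameters of `rlfToElem F hΦ`
GIVEN that it is a Frobenioid, hypothesis `hR`; support predicate `SuppR` on `Φ^rlf`).
[cite: MochizukiFrdI2008, Prop. 5.5 (iii) p.104] -/
def Prop55iii_untr_rlf_ratStd (hF : IsFrobenioid F) (hΦ : IsPerfFactorialOn Φ)
    (Supp : ∀ {X : D}, (PreFrobenioidData.ofFunctor Φ F).Mon X →
      Primes ((PreFrobenioidData.ofFunctor Φ F).Mon X) → Prop)
    (SuppR : ∀ {X : D}, (PreFrobenioidData.ofFunctor _ (rlfToElem F hΦ)).Mon X →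
      Primes ((PreFrobenioidData.ofFunctor _ (rlfToElem F hΦ)).Mon X) → Prop) : Prop :=
  IsOfType (IsFrobeniusIsotropic F) → IsOfType (IsFrobeniusNormalized F) →
    ¬ IsOfType (IsGroupLikeObj F) →
      (PreFrobenioidData.ofFunctor Φ F).IsOfRationallyStandardType (rsParams hF Supp) →
        (PreFrobenioidData.ofFunctor Φ (untrFunctor hF)).IsOfRationallyStandardType
            (rsParams (isFrobenioid_untr hF) Supp) ∧
          ∀ hR : IsFrobenioid (rlfToElem F hΦ),
            (PreFrobenioidData.ofFunctor _ (rlfToElem F hΦ)).IsOfRationallyStandardType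
              (rsParams hR SuppR)

end FrdI.Prop55Sub

/-! ### Proposition 5.5 (iv): the operations applied to a model Frobenioid -/

namespace FrdI.Prop55Sub

open PreFrobenioid

variable {D : Type u} [Category.{v} D] (Φ B : Dᵒᵖ ⥤ CommMonCat.{w}) (DivB : B ⟶ monoidGp Φ)

/-- **Proposition 5.5 (iv)**, `C^pf` (p. 104 ll. 40–43; named statement over THE perfection): for `C` the
model Frobenioid of `(Φ, B, Div_B)` under the standing hypotheses of Thm. 5.2 (`ModelFrobenioid.Hypotheses`,
which make `C → F_Φ` a Frobenioid, Thm. 5.2 (ii)) and perfected data `Div_B^pf` (`IsPerfectedDiv`), "a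
natural equivalence … between `C^pf` and the model Frobenioid associated to the data
`Φ^pf, B^pf, B^pf → (Φ^gp)^pf`", lying over `D` (the standing hypothesis "Frobenius-isotropic and
Frobenius-normalized type" of Prop. 5.5 is kept as the printed antecedent). [cite: MochizukiFrdI2008, Prop. 5.5 (iv) p.104] -/
def Prop55iv_pf (h : ModelFrobenioid.Hypotheses Φ B)
    (DivBpf : perfectionFunctor B ⟶ monoidGp (perfectionFunctor Φ)) : Prop :=
  IsOfType (IsFrobeniusIsotropic (ModelFrobenioid.toElem Φ B DivB)) →
    IsOfType (IsFrobeniusNormalized (ModelFrobenioid.toElem Φ B DivB)) → IsPerfectedDiv Φ B DivB DivBpf →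
    ∃ e : PreFrobenioid.Perfection (h.isFrobenioid Φ B DivB) ≌
        ModelFrobenioid (perfectionFunctor Φ) (perfectionFunctor B) DivBpf,
      Nonempty (e.functor ⋙ ModelFrobenioid.baseFunctor _ _ _ ≅
        (Perfection.ops (h.isFrobenioid Φ B DivB)).base)

/-- **Proposition 5.5 (iv)**, `C^un-tr` (p. 104 ll. 40–44; named statement over THE unit-trivialisation):
for `C` the model Frobenioid of `(Φ, B, Div_B)` under the standing hypotheses of Thm. 5.2, "a natural
equivalence … between `C^un-tr` and the model Frobenioid associated to the data `Φ, Φ^birat, Φ^birat ↪ Φ^gp`"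
(`Φ^birat` = image of `Div_B`, `GpSubfunctor.ofModelData`), compatible ON THE NOSE with the structure
functors to `F_Φ` (`untrFunctor` of the model Frobenioid, resp. `ModelFrobenioid.toElem`).
[cite: MochizukiFrdI2008, Prop. 5.5 (iv) p.104] -/
def Prop55iv_untr (h : ModelFrobenioid.Hypotheses Φ B) : Prop :=
  IsOfType (IsFrobeniusIsotropic (ModelFrobenioid.toElem Φ B DivB)) →
    IsOfType (IsFrobeniusNormalized (ModelFrobenioid.toElem Φ B DivB)) →
  ∃ e : (ModelFrobenioid.data Φ B DivB).Untr ≌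
      (GpSubfunctor.ofModelData Φ B DivB (fun A b => (h.isGroupLike_rat (unop A)).isUnit b)).ModelOf,
    Nonempty (e.functor ⋙ ModelFrobenioid.toElem Φ _ _ ≅ untrFunctor (h.isFrobenioid Φ B DivB))

/-- **Proposition 5.5 (iv)**, `C^rlf` (p. 104 ll. 40–44; named statement over THE realification): for `C`
the model Frobenioid of `(Φ, B, Div_B)` with `B` group-like and `Φ` perf-factorial, "a natural equivalence …
between `C^rlf` and the model Frobenioid associated to the data `Φ^rlf, ℝ · Φ^birat, ℝ · Φ^birat ↪ (Φ^rlf)^gp`"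
(`Φ^birat` = image of `Div_B`; `Φ^rlf`, `ℝ · (−)` of THE realification data `RealificationData.canonical`),
compatible on the nose with the structure functors to `F_{Φ^rlf}`. (Here `C^rlf = rlf` is built from the
concrete `biratSubfunctor` of `C`; the content is its agreement with the image of `Div_B`, Thm. 5.2 (ii).)
[cite: MochizukiFrdI2008, Prop. 5.5 (iv) p.104] -/
def Prop55iv_rlf (hB : ∀ (A : Dᵒᵖ) (b : B.obj A), IsUnit b) (hΦ : IsPerfFactorialOn Φ) : Prop :=
  IsOfType (IsFrobeniusIsotropic (ModelFrobenioid.toElem Φ B DivB)) →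
    IsOfType (IsFrobeniusNormalized (ModelFrobenioid.toElem Φ B DivB)) →
  ∃ e : rlf (ModelFrobenioid.toElem Φ B DivB) hΦ ≌
      (RealificationData.canonical Φ (IsPerfFactorialOn.op hΦ)).RlfModelOf
        (GpSubfunctor.ofModelData Φ B DivB hB),
    Nonempty (e.functor ⋙ ModelFrobenioid.toElem _ _ _ ≅ rlfToElem (ModelFrobenioid.toElem Φ B DivB) hΦ)

end FrdI.Prop55Sub

end Literature.AlgebraicGeometry.Frobenioids

end
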